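import Summits.CriticalPhenomena.SAWScalingLimit.Theorems.ArrivalFlattening.Negative.FourBall

/-!
# `ArrivalFlattening` (route SAWSpinMonotone, crux stmt-CriticalPhenomena-16770): depth is load-bearing, the order `∀Λ ∃R` is vacuous, single ports never flatten

Negative-side (cdisprove) lemmas for the crux
`Summit.CriticalPhenomena.SAWScalingLimit.Theses.SAWSpinMonotone.ArrivalFlattening` —
`∀ ε > 0 ∃ R ∀ Λ` simply connected `∀ a ∈ ∂Λ ∀ v ∈ Λ` with the Euclidean `R`-ball of lattice vertices of `v`
inside `Λ`, for all pairwise distinct neighbours `w₀ w₁ w₂` of `v`: `‖A_v(11/8)‖ ≤ ε ‖A_v(5/8)‖`, where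
`A_v(s) = arrivalTransform Λ a v w₀ w₁ w₂ s = Σⱼ F_{Λ.erase v}(a, {v,wⱼ}; x_c, s)` is the spin-`s` transform of the
first-arrival winding law (vocabulary of `…Theorems.SAWSpinMonotoneArrivalFlatteningSpinChordDefs`).

* read-back: the crux is `∀ ε > 0, ∃ R, AtDepth R (‖A(11/8)‖ ≤ ε ‖A(5/8)‖)` by `Iff.rfl` — already landed as
  `…Cruxes.ArrivalFlattening.SpinChord.arrivalFlattening_iff_atDepth` (`Theorems/SAWSpinMonotoneArrivalFlatteningReduction.lean`).
* `norm_obs_eleven_eighths_eq` — **single-port alias**: for every domain, boundary root `a` and edge `{v,t}`,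
  `‖F(a,{v,t};x,11/8)‖ = ‖F(a,{v,t};x,5/8)‖` (spin dictionary of `HexParafermionSpinShift` at `σ = 11/8` and
  `F(-σ) = conj F(σ)`); hence `portwiseFlattening_iff_vanishing`: the strengthening "each port flattens at depth"
  is equivalent to "the `5/8`-port values vanish identically beyond some depth", refuted for `R < 1` by
  `not_portwise_of_lt_one`. Flattening is pure interference of the three ports.
* `arrivalFlattening_false_without_depth` — **the depth hypothesis is load-bearing**: with "the `R`-ball of `v` lies in
  `Λ`" deleted the statement fails at `ε = 1/2` on the 4-vertex ball `Λ₄ = {V0, U0, N1, N2}` (root `{E0, U0}`,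
  `v = V0`, ports `U0, N1, N2`): `Λ₄ ∖ V0` is an independent set, the only walk is `[U0]`, `‖A(s)‖ = x_c` for every
  spin (the witness and its geometry: `Negative/FourBall.lean`). Nothing lies strictly between the shells `1/√3` and `1`, so
  `not_atDepth_of_lt_one` / `one_le_of_atDepth`: **every depth admissible for some `ε < 1` is `≥ 1`**.
* `arrivalFlatteningNonUniform_holds` — **quantifier order**: `∀ ε ∀ Λ ∀ a ∃ R ∀ v …` is vacuously true
  (`R := Σ_w dist(c u, c w)`, `u` the outer end of the root); all content is in `∃ R ∀ Λ`.

Sources: H. Duminil-Copin, S. Smirnov, Ann. of Math. 175 (2012) 1653–1665 (arXiv:1007.0575), §1–2; the crux work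
file `Cruxes/ArrivalFlattening/Disproof.lean`. Sorry-free; axioms `propext`, `Classical.choice`, `Quot.sound`.
-/

noncomputable section

open Literature.Probability.LatticeModels Literature.Probability.RandomPlanarGeometry.SAW
open Summit.CriticalPhenomena.SAWScalingLimit.Theses.SAWSpinMonotone
open Summit.CriticalPhenomena.SAWScalingLimit.Cruxes.ArrivalFlattening.SpinChord
open Summit.CriticalPhenomena.SAWScalingLimit.Theorems
open Summit.CriticalPhenomena.SAWScalingLimit.Theorems.DefectDecoherence.TipMartingale
  (dist_sq_eq_normSq exterior_preconnected)
open scoped ComplexConjugate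

namespace Summit.CriticalPhenomena.SAWScalingLimit.Theorems.ArrivalFlattening.Negative


/-! ## §0 Read-back -/

/-- The transform is symmetric under swapping the last two ports … [folklore] -/
theorem arrivalTransform_swap₁₂ (Λ : Finset HexVertex) (a : Sym2 HexVertex) (v w₀ w₁ w₂ : HexVertex) (s : ℝ) :
    arrivalTransform Λ a v w₀ w₂ w₁ s = arrivalTransform Λ a v w₀ w₁ w₂ s := by
  unfold arrivalTransform; ring

/-- … and the first two: the six labellings of the crux are ONE inequality per vertex. [folklore] -/
theorem arrivalTransform_swap₀₁ (Λ : Finset HexVertex) (a : Sym2 HexVertex) (v w₀ w₁ w₂ : HexVertex) (s : ℝ) :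
    arrivalTransform Λ a v w₁ w₀ w₂ s = arrivalTransform Λ a v w₀ w₁ w₂ s := by
  unfold arrivalTransform; ring

/-! ## §0c The single-port alias `‖F(11/8)‖ = ‖F(5/8)‖` -/

/-- Reversing the spin conjugates the weight (real fugacity). [folklore] -/
theorem weight_neg_spin {Λ : Finset HexVertex} {a z : Sym2 HexVertex} (γ : HexMidEdgeSAW Λ a z) (x σ : ℝ) :
    γ.weight x (-σ) = conj (γ.weight x σ) := by
  simp only [HexMidEdgeSAW.weight, map_mul, map_pow, Complex.conj_ofReal, ← Complex.exp_conj, map_neg,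
    Complex.conj_I, Complex.ofReal_neg]
  congr 2
  ring

/-- **`F(a, z; x, -σ) = conj F(a, z; x, σ)`** for real fugacity. [folklore] -/
theorem obs_neg_spin (Λ : Finset HexVertex) (a : Sym2 HexVertex) (x σ : ℝ) (z : Sym2 HexVertex) :
    hexParafermionicObservable Λ a x (-σ) z = conj (hexParafermionicObservable Λ a x σ z) := by
  rw [hexParafermionicObservable, hexParafermionicObservable, map_sum]
  exact Finset.sum_congr rfl fun γ _ => weight_neg_spin γ x σ

/-- **Single-port alias.** For every domain `Λ'`, boundary root `a ∈ ∂Λ'` and lattice edge `{v, t}`: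
`‖F(a,{v,t};x,11/8)‖ = ‖F(a,{v,t};x,5/8)‖` — spin `11/8 = 2 - 5/8` is the alias of `-5/8` (spin dictionary
`F(σ - 2) = ((c t - c v)/(c w₁ - c u))² F(σ)`, both edges of length `1/√3`) and `F(-5/8) = conj F(5/8)`.
Consequence: no single mid-edge flattens; `ArrivalFlattening` is a statement about the INTERFERENCE of the
three port values (it is the clockwise Beltrami mode of the first-arrival triple against its sum mode). [folklore] -/
theorem norm_obs_eleven_eighths_eq {Λ' : Finset HexVertex} {a : Sym2 HexVertex} (ha : a ∈ hexDomainBoundary Λ')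
    {v t : HexVertex} (hvt : hexGraph.Adj v t) (x : ℝ) :
    ‖hexParafermionicObservable Λ' a x (11 / 8) s(v, t)‖ = ‖hexParafermionicObservable Λ' a x (5 / 8) s(v, t)‖ := by
  obtain ⟨he, u, w₁, rfl, hw₁, hu⟩ := ha
  have huw : hexGraph.Adj u w₁ := by simpa using he
  have h := hexParafermionicObservable_spin_sub_two (w₁ := w₁) hu hvt x (11 / 8)
  rw [show (11 / 8 : ℝ) - 2 = -(5 / 8) by norm_num, obs_neg_spin] at h
  have hn := congrArg (fun z : ℂ => ‖z‖) h
  simp only [norm_mul, norm_pow, norm_div, Complex.norm_conj] at hn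
  rw [norm_hexCenter_sub_of_adj hvt, norm_hexCenter_sub_of_adj huw, div_self, one_pow, one_mul] at hn
  · exact hn.symm
  · exact inv_ne_zero (Real.sqrt_ne_zero'.2 (by norm_num))

/-- A boundary mid-edge of `Λ` not touching `v` is a boundary mid-edge of `Λ.erase v`. [folklore] -/
theorem mem_boundary_erase {Λ : Finset HexVertex} {a : Sym2 HexVertex} (ha : a ∈ hexDomainBoundary Λ)
    {v : HexVertex} (hv : v ∉ a) : a ∈ hexDomainBoundary (Λ.erase v) := by
  obtain ⟨he, u, w₁, rfl, hw₁, hu⟩ := ha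
  refine ⟨he, u, w₁, rfl, ?_, ?_⟩
  · exact Finset.mem_erase.2 ⟨fun h => hv (h ▸ Sym2.mem_mk_right u w₁), hw₁⟩
  · exact fun h => hu (Finset.mem_of_mem_erase h)

/-- At depth `R ≥ 1/√3` the root does not touch `v` (its outer end lies outside `Λ`, the neighbours of `v` inside). [folklore] -/
theorem not_mem_root_of_deep {Λ : Finset HexVertex} {a : Sym2 HexVertex} (ha : a ∈ hexDomainBoundary Λ)
    {v : HexVertex} {R : ℝ} (hR : (Real.sqrt 3)⁻¹ ≤ R)
    (hball : ∀ w : HexVertex, dist (hexCenter w) (hexCenter v) ≤ R → w ∈ Λ) : v ∉ a := by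
  obtain ⟨he, u, w₁, rfl, hw₁, hu⟩ := ha
  have huw : hexGraph.Adj u w₁ := by simpa using he
  intro hv
  rcases Sym2.mem_iff.1 hv with rfl | rfl
  · exact hu (hball _ (by rw [dist_self]; exact le_trans (by positivity) hR))
  · apply hu; apply hball
    rw [dist_eq_norm, norm_hexCenter_sub_of_adj huw.symm]
    exact hR

/-- **Portwise flattening ⟺ the `5/8`-port values vanish identically beyond some depth.** The natural
strengthening of the crux "each PORT flattens at depth" (`∀ ε > 0 ∃ R`, at every admissible `R`-deep configuration
`‖F_{Λ∖v}(a,{v,w₀};11/8)‖ ≤ ε ‖F_{Λ∖v}(a,{v,w₀};5/8)‖`) is, by the alias with `ε = 1/2`, equivalent to identical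
vanishing of the port values — false at every computed depth (every port carries walks) and provably false for
`R < 1` (`not_portwise_of_lt_one`). [folklore] -/
theorem portwiseFlattening_iff_vanishing :
    (∀ ε : ℝ, 0 < ε → ∃ R : ℝ, AtDepth R (fun Λ a v w₀ _ _ =>
      ‖hexParafermionicObservable (Λ.erase v) a hexCriticalFugacity (11 / 8) s(v, w₀)‖ ≤
        ε * ‖hexParafermionicObservable (Λ.erase v) a hexCriticalFugacity (5 / 8) s(v, w₀)‖)) ↔
    ∃ R : ℝ, AtDepth R (fun Λ a v w₀ _ _ =>
      hexParafermionicObservable (Λ.erase v) a hexCriticalFugacity (5 / 8) s(v, w₀) = 0) := by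
  constructor
  · intro h
    obtain ⟨R, hR⟩ := h (1 / 2) (by norm_num)
    refine ⟨max R (Real.sqrt 3)⁻¹, ?_⟩
    intro Λ hΛ a ha v hv hball w₀ w₁ w₂ h₀ h₁ h₂ h₀₁ h₁₂ h₀₂
    have hball' : ∀ w : HexVertex, dist (hexCenter w) (hexCenter v) ≤ R → w ∈ Λ :=
      fun w hw => hball w (hw.trans (le_max_left _ _))
    have key := hR Λ hΛ a ha v hv hball' w₀ w₁ w₂ h₀ h₁ h₂ h₀₁ h₁₂ h₀₂
    dsimp only at key ⊢
    have ha' : a ∈ hexDomainBoundary (Λ.erase v) :=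
      mem_boundary_erase ha (not_mem_root_of_deep ha (le_max_right _ _) hball)
    rw [norm_obs_eleven_eighths_eq ha' h₀] at key
    have h0 : ‖hexParafermionicObservable (Λ.erase v) a hexCriticalFugacity (5 / 8) s(v, w₀)‖ ≤ 0 := by
      linarith [norm_nonneg (hexParafermionicObservable (Λ.erase v) a hexCriticalFugacity (5 / 8) s(v, w₀))]
    exact norm_eq_zero.1 (le_antisymm h0 (norm_nonneg _))
  · rintro ⟨R, hR⟩ ε hε
    refine ⟨max R (Real.sqrt 3)⁻¹, ?_⟩
    intro Λ hΛ a ha v hv hball w₀ w₁ w₂ h₀ h₁ h₂ h₀₁ h₁₂ h₀₂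
    have hball' : ∀ w : HexVertex, dist (hexCenter w) (hexCenter v) ≤ R → w ∈ Λ :=
      fun w hw => hball w (hw.trans (le_max_left _ _))
    have key := hR Λ hΛ a ha v hv hball' w₀ w₁ w₂ h₀ h₁ h₂ h₀₁ h₁₂ h₀₂
    dsimp only at key ⊢
    have ha' : a ∈ hexDomainBoundary (Λ.erase v) :=
      mem_boundary_erase ha (not_mem_root_of_deep ha (le_max_right _ _) hball)
    rw [norm_obs_eleven_eighths_eq ha' h₀, key, norm_zero, mul_zero]

/-! ### The load-bearing statement -/

/-- **The flattening inequality fails on the 4-ball for every `ε < 1`** (both sides have modulus `x_c`). -/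
theorem not_flat_Λ₄ {ε : ℝ} (hε : ε < 1) :
    ¬ (‖arrivalTransform ({(((0 : Site 2)), (0 : Fin 2)), (((0 : Site 2)), (1 : Fin 2)), ((-(Pi.single 0 1 : Site 2)), (1 : Fin 2)), ((-(Pi.single 1 1 : Site 2)), (1 : Fin 2))} : Finset HexVertex) s((((Pi.single 0 1 : Site 2)), (0 : Fin 2)), (((0 : Site 2)), (1 : Fin 2))) (((0 : Site 2)), (0 : Fin 2))
        (((0 : Site 2)), (1 : Fin 2)) ((-(Pi.single 0 1 : Site 2)), (1 : Fin 2)) ((-(Pi.single 1 1 : Site 2)), (1 : Fin 2)) (11 / 8)‖ ≤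
      ε * ‖arrivalTransform ({(((0 : Site 2)), (0 : Fin 2)), (((0 : Site 2)), (1 : Fin 2)), ((-(Pi.single 0 1 : Site 2)), (1 : Fin 2)), ((-(Pi.single 1 1 : Site 2)), (1 : Fin 2))} : Finset HexVertex) s((((Pi.single 0 1 : Site 2)), (0 : Fin 2)), (((0 : Site 2)), (1 : Fin 2))) (((0 : Site 2)), (0 : Fin 2))
        (((0 : Site 2)), (1 : Fin 2)) ((-(Pi.single 0 1 : Site 2)), (1 : Fin 2)) ((-(Pi.single 1 1 : Site 2)), (1 : Fin 2)) (5 / 8)‖) := by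
  rw [norm_arrivalTransform_Λ₄, norm_arrivalTransform_Λ₄]
  intro h
  have hx := hexCriticalFugacity_pos_lt_one.1
  nlinarith

/-- **The depth hypothesis of `ArrivalFlattening` is load-bearing**: with the `R`-ball hypothesis deleted the
statement (displayed: the crux with that hypothesis removed, `R` then plays no role) is false — witness `ε = 1/2`,
`Λ₄`, root `{E0, U0}`, `v = V0`, ports `(U0, N1, N2)`: one walk, ratio `1`. Any proof must use that `v` is deep. [folklore] -/
theorem arrivalFlattening_false_without_depth : ¬ (∀ ε : ℝ, 0 < ε → ∀ (Λ : Finset HexVertex),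
    hexDomainSimplyConnected Λ → ∀ a ∈ hexDomainBoundary Λ, ∀ v ∈ Λ, ∀ w₀ w₁ w₂ : HexVertex,
    hexGraph.Adj v w₀ → hexGraph.Adj v w₁ → hexGraph.Adj v w₂ → w₀ ≠ w₁ → w₁ ≠ w₂ → w₀ ≠ w₂ →
    ‖arrivalTransform Λ a v w₀ w₁ w₂ (11 / 8)‖ ≤ ε * ‖arrivalTransform Λ a v w₀ w₁ w₂ (5 / 8)‖) := by
  intro h
  exact not_flat_Λ₄ (by norm_num : (1 / 2 : ℝ) < 1)
    (h (1 / 2) (by norm_num) ({(((0 : Site 2)), (0 : Fin 2)), (((0 : Site 2)), (1 : Fin 2)), ((-(Pi.single 0 1 : Site 2)), (1 : Fin 2)), ((-(Pi.single 1 1 : Site 2)), (1 : Fin 2))} : Finset HexVertex) Λ₄_simplyConnected _ root_mem_boundary (((0 : Site 2)), (0 : Fin 2)) (by simp)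
      _ _ _ nfb_adj_V0_U0 nfb_adj_V0_N1 nfb_adj_V0_N2 nfb_U0_ne_N1 nfb_N2_ne_N1.symm nfb_U0_ne_N2)

/-- **Depth tightness `R(ε) ≥ 1`**: for `ε < 1` no `R < 1` is admissible in the crux — the 4-ball witness is
`R`-deep for every `R < 1` (`mem_Λ₄_of_dist_lt_one`). [folklore] -/
theorem not_atDepth_of_lt_one {ε R : ℝ} (hε : ε < 1) (hR : R < 1) :
    ¬ AtDepth R (fun Λ a v w₀ w₁ w₂ =>
      ‖arrivalTransform Λ a v w₀ w₁ w₂ (11 / 8)‖ ≤ ε * ‖arrivalTransform Λ a v w₀ w₁ w₂ (5 / 8)‖) := by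
  intro h
  refine not_flat_Λ₄ hε (h ({(((0 : Site 2)), (0 : Fin 2)), (((0 : Site 2)), (1 : Fin 2)), ((-(Pi.single 0 1 : Site 2)), (1 : Fin 2)), ((-(Pi.single 1 1 : Site 2)), (1 : Fin 2))} : Finset HexVertex) Λ₄_simplyConnected _ root_mem_boundary (((0 : Site 2)), (0 : Fin 2)) (by simp)
    (fun w hw => mem_Λ₄_of_dist_lt_one (hw.trans_lt hR))
    _ _ _ nfb_adj_V0_U0 nfb_adj_V0_N1 nfb_adj_V0_N2 nfb_U0_ne_N1 nfb_N2_ne_N1.symm nfb_U0_ne_N2)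

/-- Corollary: in `ArrivalFlattening` every depth admissible for some `ε < 1` is at least `1`. [folklore] -/
theorem one_le_of_atDepth {ε R : ℝ} (hε : ε < 1)
    (h : AtDepth R (fun Λ a v w₀ w₁ w₂ =>
      ‖arrivalTransform Λ a v w₀ w₁ w₂ (11 / 8)‖ ≤ ε * ‖arrivalTransform Λ a v w₀ w₁ w₂ (5 / 8)‖)) : 1 ≤ R :=
  not_lt.1 fun hR => not_atDepth_of_lt_one hε hR h

/-- The portwise strengthening is false already because its vanishing form fails for `R < 1` on the 4-ball
(the port `U0` carries the walk `[U0]`, of non-zero weight). [folklore] -/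
theorem not_portwise_of_lt_one {R : ℝ} (hR : R < 1) :
    ¬ AtDepth R (fun Λ a v w₀ _ _ =>
      hexParafermionicObservable (Λ.erase v) a hexCriticalFugacity (5 / 8) s(v, w₀) = 0) := by
  intro h
  have key := h ({(((0 : Site 2)), (0 : Fin 2)), (((0 : Site 2)), (1 : Fin 2)), ((-(Pi.single 0 1 : Site 2)), (1 : Fin 2)), ((-(Pi.single 1 1 : Site 2)), (1 : Fin 2))} : Finset HexVertex) Λ₄_simplyConnected _ root_mem_boundary (((0 : Site 2)), (0 : Fin 2)) (by simp)
    (fun w hw => mem_Λ₄_of_dist_lt_one (hw.trans_lt hR))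
    _ _ _ nfb_adj_V0_U0 nfb_adj_V0_N1 nfb_adj_V0_N2 nfb_U0_ne_N1 nfb_N2_ne_N1.symm nfb_U0_ne_N2
  dsimp only at key
  rw [erase_V0] at key
  have hn := norm_obs_port_U0 hexCriticalFugacity_pos_lt_one.1.le (5 / 8)
  rw [key, norm_zero] at hn
  exact hexCriticalFugacity_pos_lt_one.1.ne' hn.symm

/-! ## §2 Quantifier order: `∀ Λ ∀ a ∃ R` is vacuous -/

/-- **The non-uniform form is trivially TRUE**: if `R` may depend on the domain (and the root), choose it so large
that no vertex is `R`-deep — `R := Σ_{w ∈ Λ} dist(c u, c w)` with `u ∉ Λ` the outer end of the root. All content of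
the crux is in the order `∃ R ∀ Λ`. [folklore] -/
theorem arrivalFlatteningNonUniform_holds :
    ∀ ε : ℝ, 0 < ε → ∀ (Λ : Finset HexVertex), hexDomainSimplyConnected Λ → ∀ a ∈ hexDomainBoundary Λ,
      ∃ R : ℝ, ∀ v ∈ Λ, (∀ w : HexVertex, dist (hexCenter w) (hexCenter v) ≤ R → w ∈ Λ) →
      ∀ w₀ w₁ w₂ : HexVertex, hexGraph.Adj v w₀ → hexGraph.Adj v w₁ → hexGraph.Adj v w₂ →
      w₀ ≠ w₁ → w₁ ≠ w₂ → w₀ ≠ w₂ →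
      ‖arrivalTransform Λ a v w₀ w₁ w₂ (11 / 8)‖ ≤ ε * ‖arrivalTransform Λ a v w₀ w₁ w₂ (5 / 8)‖ := by
  intro ε _ Λ _ a ha
  obtain ⟨-, u, w₁, rfl, -, hu⟩ := ha
  refine ⟨∑ w ∈ Λ, dist (hexCenter u) (hexCenter w), fun v hv hball => ?_⟩
  exfalso
  exact hu (hball u (Finset.single_le_sum (f := fun w => dist (hexCenter u) (hexCenter w))
    (fun w _ => dist_nonneg) hv))

end Summit.CriticalPhenomena.SAWScalingLimit.Theorems.ArrivalFlattening.Negative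

end
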